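import Literature.Geometry.ComplexHyperbolic.UnitBallMeasure   -- ★ `nsq`, `nsq_pos_of_ne_zero`, `isOpen_setOf_nsq_lt`, `volume_setOf_nsq_lt_lt_top` (the Euclidean unit ball of `ℂ²`); brings Mathlib
import HarnessLib

/-!
# (A4-R) Angular integration by parts on `ℂ²`: `∫_{ℂ²} DF(W)[Y W] d⁴W = 0` for the periodic isometric conjugate-linear fields `Y_A W = (W̄₁, −W̄₀)`, `Y_B = i·Y_A`
# — and the generic «PERIODIC-FLOW IBP» behind it (Rudin 1980 §1.4; Folland 1995 §2.2∕(2.15); Rogawski 1990 §8.4 pp. 126–127 for the use)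

Topic `Geometry/ComplexHyperbolic`; namespace `Literature.Geometry.ComplexHyperbolic.BallModel`.  THEOREMS ONLY (no `def`, no instance, no notation, no axiom, no named fact, no `sorry`).
Cell `pub/hodgecm-mathlib`, ENGINE T1 (crux H413 = `stmt-HodgeConjecture-24833`); ROAD A (the (L_{U(2,1)}) letter `ArchCentralLimitFormulaRankTwo` = closer `stub_L21` ∕ SdArch `stub_ArchCentralLimitU21`),
(A4-iii) «THE VALUE» — work package **W2 = (A4-R)** of F0P3a-p06 (g12)'s BLUEPRINT `BLUEPRINT-A4iii-ValueIdentity` 1a660045 §4 (the angular part of the total density is a flow-divergence; its `ℂ²`-integral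
vanishes), in the INTERFACE p06 asked for (bus 2026-09-01T11:20:35Z): `integral_fderiv_apply_Yflow_eq_zero (hF : ContDiffOn ℝ 1 F {0}ᶜ) (hT : Integrable fun W => fderiv ℝ F W (Y W)) : ∫ W, fderiv ℝ F W (Y W) = 0`
for `Y ∈ {Y_A, Y_B}`, `Y_A W = ![star (W 1), -star (W 0)]`, `Y_B W = ![I * star (W 1), -(I * star (W 0))]`; author F0P3a-p05 (g14) (ROAD A owner), 2026-09-01.

THE MATHEMATICS.
§1 (generic, any measure space `(X, μ)`, `μ` s-finite; `E` complete) **`integral_eq_zero_of_periodic_flow`**: let `R : ℝ → X → X` with every `R θ` MEASURE-PRESERVING, `0 < p`, and `F, T : X → E` with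
`T ∈ L¹(μ)`, `(x,θ) ↦ T(R θ x)` a.e.-strongly measurable on `μ ⊗ dθ|_{(0,p]}`, for a.e. `x`: `θ ↦ F(R θ x)` has derivative `T(R θ x)` on `[0,p]`, and `F(R p x) = F(R 0 x)`.  THEN `∫ T dμ = 0`.
Proof: `∫ T = ∫ T∘R_θ` for every `θ` (preservation), so `p•∫T = ∫_0^p∫_X T(R θ x) = ∫_X ∫_0^p T(R θ x) dθ` (Fubini; product integrability from `integrable_prod_iff'`: each slice is `L¹` with the SAME
norm) `= ∫_X [F(R p x) − F(R 0 x)] = 0` (FTC on each orbit).  NO dominated differentiation, NO Haar measure on a group — exactly p06's recipe.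
§2 **`measurePreserving_of_nsq_eq`**: a real-linear `f : ℂ² → ℂ²` with `nsq (f W) = nsq W` preserves Lebesgue measure (`map f vol = |det f|⁻¹ • vol` (Mathlib) evaluated on the invariant unit ball
`{nsq < 1}` of finite positive volume ★ `isOpen_setOf_nsq_lt` ∕ `volume_setOf_nsq_lt_lt_top` forces `|det f| = 1` — no determinant is computed).
§3 THE FLOWS: for a unit `u ∈ ℂ` (`u = 1`: `Y_A`; `u = I`: `Y_B`) put `Y_u W = ![u * star (W 1), -(u * star (W 0))]` (conjugate-linear, `Y_u(Y_u W) = −W`, `nsq`-skew) and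
`R_u θ W = cos θ • W + sin θ • Y_u W` (`= e^{θY_u}W`): `nsq (R_u θ W) = nsq W`, `R_u (s+t) = R_u s ∘ R_u t`, `R_u 0 = id`, `R_u (θ + 2π) = R_u θ`, `d∕dθ R_u θ W = Y_u (R_u θ W)`, continuity, and
`MeasurePreserving (R_u θ) volume volume` (§2).  (p06's factorisation `e^{θY_A} = C₁∘U_θ∘C₁` is thereby not needed.)
§4 **`integral_fderiv_apply_flowField_eq_zero`** (unit `u`) and the two named corollaries **`integral_fderiv_apply_YA_eq_zero`**, **`integral_fderiv_apply_YB_eq_zero`** = p06's interface verbatim: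
`F : ℂ² → G` of class `C¹` on `{0}ᶜ` (`G` complete), `W ↦ DF(W)[Y W]` integrable ⇒ `∫_{ℂ²} DF(W)[Y W] d⁴W = 0` (§1 with `X = ℂ²`, `p = 2π`, `T = DF[Y]`; the orbit through `W ≠ 0` avoids `0`, where `F`
need not be differentiable; `{0}` is Lebesgue-null; joint measurability from continuity of `DF` on `{0}ᶜ`).
HONEST LABEL: HC_CM is proved only modulo the printed citations until rung 0 closes; generic real analysis, pays nothing by itself.

## References
* [Rudin1980] W. Rudin, *Function Theory in the Unit Ball of ℂⁿ* (1980), §1.4 (integration on `ℂⁿ`, unitary invariance of Lebesgue measure, 1.4.3∕1.4.7).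
* [Folland1995] G. B. Folland, *A Course in Abstract Harmonic Analysis* (1995), §2.2 (invariance of Haar∕Lebesgue measure under compact groups of automorphisms).
* [Rogawski1990] J. D. Rogawski, *Automorphic Representations of Unitary Groups in Three Variables* (1990), §8.4 pp. 126–127 (the central limit formula this serves).
-/

set_option autoImplicit false

noncomputable section

open MeasureTheory Measure Set Filter Topology Complex ComplexConjugate Function
open scoped ENNReal NNReal Real

namespace Literature.Geometry.ComplexHyperbolic

namespace BallModel

/-! ## §1 The generic periodic-flow integration by parts -/

section PeriodicFlow

variable {X : Type*} [MeasurableSpace X] {μ : Measure X} [SFinite μ]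
variable {E : Type*} [NormedAddCommGroup E] [NormedSpace ℝ E] [CompleteSpace E]

/-- **PERIODIC-FLOW INTEGRATION BY PARTS.**  `R : ℝ → X → X` a family of measure-preserving maps of `(X, μ)`, `0 < p`; `T ∈ L¹(μ)` with `(x,θ) ↦ T(R θ x)` a.e.-strongly measurable on
`μ ⊗ dθ|_{(0,p]}`; for a.e. `x`, `θ ↦ F(R θ x)` has derivative `T(R θ x)` at every `θ ∈ [0,p]` and `F(R p x) = F(R 0 x)`.  THEN `∫_X T dμ = 0`:
`p • ∫T = ∫_0^p ∫_X T∘R_θ dμ dθ = ∫_X ∫_0^p (d∕dθ)F(R θ x) dθ dμ = ∫_X (F(R p x) − F(R 0 x)) dμ = 0`. [cite: Folland1995, §2.2] [cite: Rudin1980, §1.4] -/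
theorem integral_eq_zero_of_periodic_flow (R : ℝ → X → X) (hR : ∀ θ, MeasurePreserving (R θ) μ μ) {p : ℝ} (hp : 0 < p)
    (F T : X → E) (hT : Integrable T μ)
    (hTm : AEStronglyMeasurable (fun z : X × ℝ => T (R z.2 z.1)) (μ.prod (volume.restrict (Ioc 0 p))))
    (hderiv : ∀ᵐ x ∂μ, ∀ θ ∈ Icc 0 p, HasDerivAt (fun θ => F (R θ x)) (T (R θ x)) θ)
    (hper : ∀ᵐ x ∂μ, F (R p x) = F (R 0 x)) :
    ∫ x, T x ∂μ = 0 := by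
  set ν : Measure ℝ := volume.restrict (Ioc 0 p) with hν
  haveI : IsFiniteMeasure ν := by
    refine ⟨?_⟩
    rw [hν, Measure.restrict_apply MeasurableSet.univ, univ_inter, Real.volume_Ioc]
    exact ENNReal.ofReal_lt_top
  -- (1) each `R θ` preserves the integral of `T` and of `‖T‖`
  have h1 : ∀ θ, ∫ x, T (R θ x) ∂μ = ∫ x, T x ∂μ := fun θ => by
    have hm : AEStronglyMeasurable T (Measure.map (R θ) μ) := by rw [(hR θ).map_eq]; exact hT.aestronglyMeasurable
    have h := integral_map (hR θ).measurable.aemeasurable hm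
    rw [(hR θ).map_eq] at h
    exact h.symm
  have h1' : ∀ θ, ∫ x, ‖T (R θ x)‖ ∂μ = ∫ x, ‖T x‖ ∂μ := fun θ => by
    have hm : AEStronglyMeasurable (fun x => ‖T x‖) (Measure.map (R θ) μ) := by rw [(hR θ).map_eq]; exact hT.aestronglyMeasurable.norm
    have h := integral_map (hR θ).measurable.aemeasurable hm
    rw [(hR θ).map_eq] at h
    exact h.symm
  -- (2) integrability on the product `μ ⊗ ν`
  set G : X × ℝ → E := fun z => T (R z.2 z.1) with hG_def
  have hG : Integrable G (μ.prod ν) := by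
    rw [integrable_prod_iff' hTm]
    refine ⟨Eventually.of_forall fun θ => ?_, ?_⟩
    · exact (hR θ).integrable_comp_of_integrable hT
    · have hc : (fun θ => ∫ x, ‖G (x, θ)‖ ∂μ) = fun _ => ∫ x, ‖T x‖ ∂μ := funext fun θ => h1' θ
      rw [hc]
      exact integrable_const _
  -- (3) Fubini both ways; the `θ`-first side is `p • ∫ T`
  have hswap : ∫ x, ∫ θ, G (x, θ) ∂ν ∂μ = ∫ θ, ∫ x, G (x, θ) ∂μ ∂ν := by
    rw [← integral_prod G hG, integral_prod_symm G hG]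
  have hright : ∫ θ, ∫ x, G (x, θ) ∂μ ∂ν = ν.real univ • ∫ x, T x ∂μ := by
    have hc : (fun θ => ∫ x, G (x, θ) ∂μ) = fun _ => ∫ x, T x ∂μ := funext fun θ => h1 θ
    rw [hc, integral_const]
  -- (4) the `x`-first side vanishes: FTC along each orbit, then periodicity
  have hinner : ∀ᵐ x ∂μ, ∫ θ, G (x, θ) ∂ν = F (R p x) - F (R 0 x) := by
    filter_upwards [hderiv, hG.prod_right_ae] with x hx hix
    have hii : IntervalIntegrable (fun θ => T (R θ x)) volume 0 p := (intervalIntegrable_iff_integrableOn_Ioc_of_le hp.le).2 hix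
    have hI : (∫ θ, G (x, θ) ∂ν) = ∫ θ in (0 : ℝ)..p, T (R θ x) := by rw [intervalIntegral.integral_of_le hp.le]
    rw [hI]
    exact intervalIntegral.integral_eq_sub_of_hasDerivAt (fun θ hθ => hx θ (by rwa [uIcc_of_le hp.le] at hθ)) hii
  have hleft : ∫ x, ∫ θ, G (x, θ) ∂ν ∂μ = 0 := by
    rw [integral_congr_ae hinner]
    have h0 : (fun x => F (R p x) - F (R 0 x)) =ᵐ[μ] fun _ => (0 : E) := by
      filter_upwards [hper] with x hx
      rw [hx, sub_self]
    rw [integral_congr_ae h0, integral_zero]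
  -- (5) conclude
  have hνp : ν.real univ = p := by
    rw [measureReal_def, hν, Measure.restrict_apply MeasurableSet.univ, univ_inter, Real.volume_Ioc, sub_zero, ENNReal.toReal_ofReal hp.le]
  have hfin : p • ∫ x, T x ∂μ = 0 := by rw [← hνp, ← hright, ← hswap, hleft]
  exact (smul_eq_zero.1 hfin).resolve_left hp.ne'

end PeriodicFlow

/-! ## §2 `nsq`-preserving real-linear maps of `ℂ²` preserve Lebesgue measure -/

section NsqPreserving

/-- The Euclidean unit ball `{nsq < 1}` of `ℂ²` has positive Lebesgue measure (it is open ★ `isOpen_setOf_nsq_lt` and contains `0`). [cite: Rudin1980, §1.4] -/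
theorem volume_setOf_nsq_lt_one_pos : 0 < volume {W : Fin 2 → ℂ | nsq W < 1} :=
  isOpen_setOf_nsq_lt.measure_pos volume ⟨0, by simp [nsq]⟩

/-- **AN `nsq`-PRESERVING REAL-LINEAR MAP OF `ℂ²` PRESERVES LEBESGUE MEASURE**: `map f vol = |det f|⁻¹ • vol` (Mathlib `map_linearMap_addHaar_eq_smul_addHaar`), and both sides give the invariant
ball `{nsq < 1}` the same finite positive mass, so the scalar is `1`.  (`f` is injective since `nsq (f W) = 0 ⇒ W = 0`, hence `det f ≠ 0`.) [cite: Rudin1980, §1.4 (1.4.7)] [cite: Folland1995, §2.2] -/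
theorem measurePreserving_of_nsq_eq (f : (Fin 2 → ℂ) →ₗ[ℝ] (Fin 2 → ℂ)) (hf : ∀ W, nsq (f W) = nsq W) :
    MeasurePreserving f volume volume := by
  -- `det f ≠ 0`
  have hinj : Function.Injective f := by
    intro x y hxy
    by_contra hne
    have hpos : 0 < nsq (x - y) := nsq_pos_of_ne_zero (sub_ne_zero.2 hne)
    have h0 : nsq (f (x - y)) = 0 := by rw [map_sub, hxy, sub_self]; simp [nsq]
    rw [hf] at h0
    exact hpos.ne' h0
  have hunit : IsUnit f := (LinearMap.isUnit_iff_ker_eq_bot f).2 (LinearMap.ker_eq_bot.2 hinj)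
  have hdet : LinearMap.det f ≠ 0 := (LinearMap.isUnit_det f hunit).ne_zero
  have hmap := map_linearMap_addHaar_eq_smul_addHaar (volume : Measure (Fin 2 → ℂ)) hdet
  -- evaluate on the invariant ball
  set B : Set (Fin 2 → ℂ) := {W | nsq W < 1} with hB
  have hBm : MeasurableSet B := isOpen_setOf_nsq_lt.measurableSet
  have hpre : f ⁻¹' B = B := by
    ext W
    simp only [mem_preimage, hB, mem_setOf_eq, hf]
  have hfm : Measurable f := (LinearMap.continuous_of_finiteDimensional f).measurable
  have hval : volume B = ENNReal.ofReal |(LinearMap.det f)⁻¹| * volume B := by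
    have h := congrArg (fun m : Measure (Fin 2 → ℂ) => m B) hmap
    simp only [Measure.smul_apply, smul_eq_mul] at h
    rwa [Measure.map_apply hfm hBm, hpre] at h
  have hc : ENNReal.ofReal |(LinearMap.det f)⁻¹| = 1 := by
    have h0 : volume B ≠ 0 := volume_setOf_nsq_lt_one_pos.ne'
    have ht : volume B ≠ ∞ := volume_setOf_nsq_lt_lt_top.ne
    have h2 : volume B * 1 = volume B * ENNReal.ofReal |(LinearMap.det f)⁻¹| := by rw [mul_one, mul_comm]; exact hval
    exact ((ENNReal.mul_right_inj h0 ht).1 h2).symm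
  refine ⟨hfm, ?_⟩
  rw [hmap, hc, one_smul]

end NsqPreserving

/-! ## §3 The conjugate-linear unit fields `Y_u W = (u·W̄₁, −u·W̄₀)` and their flows `R_u θ = cos θ + sin θ·Y_u` -/

section Flow

/-- `Y_u` is additive. [cite: Rudin1980, §1.4] -/
theorem field_add (u : ℂ) (W V : Fin 2 → ℂ) :
    (![u * star ((W + V) 1), -(u * star ((W + V) 0))] : Fin 2 → ℂ) = ![u * star (W 1), -(u * star (W 0))] + ![u * star (V 1), -(u * star (V 0))] := by
  ext i; fin_cases i <;> simp <;> ring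

/-- `Y_u` commutes with REAL scalars. [cite: Rudin1980, §1.4] -/
theorem field_real_smul (u : ℂ) (a : ℝ) (W : Fin 2 → ℂ) :
    (![u * star ((a • W) 1), -(u * star ((a • W) 0))] : Fin 2 → ℂ) = a • ![u * star (W 1), -(u * star (W 0))] := by
  ext i; fin_cases i <;> simp [Complex.real_smul] <;> ring

/-- **`Y_u² = −1`** for `|u| = 1`: `Y_u (Y_u W) = −W`. [cite: Rudin1980, §1.4] -/
theorem field_field (u : ℂ) (hu : star u * u = 1) (W : Fin 2 → ℂ) :
    (![u * star ((![u * star (W 1), -(u * star (W 0))] : Fin 2 → ℂ) 1), -(u * star ((![u * star (W 1), -(u * star (W 0))] : Fin 2 → ℂ) 0))] : Fin 2 → ℂ) = -W := by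
  ext i; fin_cases i
  · simp; linear_combination (W 0) * hu
  · simp; linear_combination (W 1) * hu

/-- **THE FLOW IS `nsq`-ISOMETRIC**: `nsq (cos θ • W + sin θ • Y_u W) = nsq W` (`|u| = 1`; the cross terms `2 cos θ sin θ · Re(ū W₀W₁ − ū W₁W₀)` cancel). [cite: Rudin1980, §1.4 (1.4.7)] -/
theorem nsq_flow (u : ℂ) (hu : ‖u‖ = 1) (θ : ℝ) (W : Fin 2 → ℂ) :
    nsq (Real.cos θ • W + Real.sin θ • ![u * star (W 1), -(u * star (W 0))]) = nsq W := by
  have hcs := Real.cos_sq_add_sin_sq θ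
  have hu2 : u.re ^ 2 + u.im ^ 2 = 1 := by
    have h := Complex.sq_norm u
    rw [hu, one_pow, Complex.normSq_apply] at h
    nlinarith [h]
  simp only [nsq, Pi.add_apply, Pi.smul_apply, Matrix.cons_val_zero, Matrix.cons_val_one, Complex.real_smul, Complex.sq_norm, Complex.normSq_apply,
    Complex.add_re, Complex.add_im, Complex.mul_re, Complex.mul_im, Complex.ofReal_re, Complex.ofReal_im, Complex.neg_re, Complex.neg_im, Complex.star_def, Complex.conj_re, Complex.conj_im]
  -- the identity is polynomial in `cos θ, sin θ, u.re, u.im, W.re, W.im` given `cos²+sin² = 1`, `|u|² = 1` (the cross terms cancel identically)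
  linear_combination ((W 0).re ^ 2 + (W 0).im ^ 2 + (W 1).re ^ 2 + (W 1).im ^ 2) * hcs
    + (Real.sin θ ^ 2 * ((W 0).re ^ 2 + (W 0).im ^ 2 + (W 1).re ^ 2 + (W 1).im ^ 2)) * hu2

/-- `R_u 0 = id`. [cite: Rudin1980, §1.4] -/
theorem flow_zero (u : ℂ) (W : Fin 2 → ℂ) : Real.cos 0 • W + Real.sin 0 • (![u * star (W 1), -(u * star (W 0))] : Fin 2 → ℂ) = W := by
  simp

/-- `R_u` is `2π`-periodic. [cite: Rudin1980, §1.4] -/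
theorem flow_add_two_pi (u : ℂ) (θ : ℝ) (W : Fin 2 → ℂ) :
    Real.cos (θ + 2 * π) • W + Real.sin (θ + 2 * π) • (![u * star (W 1), -(u * star (W 0))] : Fin 2 → ℂ) =
      Real.cos θ • W + Real.sin θ • ![u * star (W 1), -(u * star (W 0))] := by
  rw [Real.cos_add_two_pi, Real.sin_add_two_pi]

/-- **THE GROUP LAW `R_u (s+t) = R_u s ∘ R_u t`** (`|u| = 1`, `Y_u² = −1`, addition formulas). [cite: Rudin1980, §1.4] -/
theorem flow_add (u : ℂ) (hu : star u * u = 1) (s t : ℝ) (W : Fin 2 → ℂ) :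
    Real.cos (s + t) • W + Real.sin (s + t) • (![u * star (W 1), -(u * star (W 0))] : Fin 2 → ℂ) =
      Real.cos s • (Real.cos t • W + Real.sin t • ![u * star (W 1), -(u * star (W 0))])
        + Real.sin s • ![u * star ((Real.cos t • W + Real.sin t • (![u * star (W 1), -(u * star (W 0))] : Fin 2 → ℂ)) 1),
            -(u * star ((Real.cos t • W + Real.sin t • (![u * star (W 1), -(u * star (W 0))] : Fin 2 → ℂ)) 0))] := by
  have hu' : conj u * u = 1 := by simpa only [Complex.star_def] using hu
  rw [Real.cos_add, Real.sin_add]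
  ext i; fin_cases i
  · simp only [Fin.isValue, Fin.zero_eta, Pi.add_apply, Pi.smul_apply, Matrix.cons_val_zero, Matrix.cons_val_one, Complex.real_smul, map_add, map_mul, map_neg, Complex.conj_ofReal, Complex.star_def, Complex.conj_conj, Complex.ofReal_mul, Complex.ofReal_sub, Complex.ofReal_add]
    linear_combination ((Real.sin s : ℂ) * Real.sin t * W 0) * hu'
  · simp only [Fin.isValue, Fin.mk_one, Pi.add_apply, Pi.smul_apply, Matrix.cons_val_zero, Matrix.cons_val_one, Complex.real_smul, map_add, map_mul, map_neg, Complex.conj_ofReal, Complex.star_def, Complex.conj_conj, Complex.ofReal_mul, Complex.ofReal_sub, Complex.ofReal_add]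
    linear_combination ((Real.sin s : ℂ) * Real.sin t * W 1) * hu'

/-- **`d∕dθ R_u θ W = Y_u (R_u θ W)`**: the flow is generated by the field (`|u| = 1`). [cite: Rudin1980, §1.4] -/
theorem hasDerivAt_flow (u : ℂ) (hu : star u * u = 1) (θ : ℝ) (W : Fin 2 → ℂ) :
    HasDerivAt (fun θ : ℝ => Real.cos θ • W + Real.sin θ • (![u * star (W 1), -(u * star (W 0))] : Fin 2 → ℂ))
      (![u * star ((Real.cos θ • W + Real.sin θ • (![u * star (W 1), -(u * star (W 0))] : Fin 2 → ℂ)) 1),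
          -(u * star ((Real.cos θ • W + Real.sin θ • (![u * star (W 1), -(u * star (W 0))] : Fin 2 → ℂ)) 0))]) θ := by
  have h : HasDerivAt (fun θ : ℝ => Real.cos θ • W + Real.sin θ • (![u * star (W 1), -(u * star (W 0))] : Fin 2 → ℂ))
      ((-Real.sin θ) • W + Real.cos θ • (![u * star (W 1), -(u * star (W 0))] : Fin 2 → ℂ)) θ :=
    ((Real.hasDerivAt_cos θ).smul_const W).add ((Real.hasDerivAt_sin θ).smul_const _)
  have hu' : conj u * u = 1 := by simpa only [Complex.star_def] using hu
  convert h using 1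
  ext i; fin_cases i
  · simp only [Fin.isValue, Fin.zero_eta, Pi.add_apply, Pi.smul_apply, Matrix.cons_val_zero, Matrix.cons_val_one, Complex.real_smul, map_add, map_mul, map_neg, Complex.conj_ofReal, Complex.star_def, Complex.conj_conj, Complex.ofReal_neg]
    linear_combination (-((Real.sin θ : ℂ) * W 0)) * hu'
  · simp only [Fin.isValue, Fin.mk_one, Pi.add_apply, Pi.smul_apply, Matrix.cons_val_zero, Matrix.cons_val_one, Complex.real_smul, map_add, map_mul, map_neg, Complex.conj_ofReal, Complex.star_def, Complex.conj_conj, Complex.ofReal_neg]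
    linear_combination (-((Real.sin θ : ℂ) * W 1)) * hu'

/-- The flow is jointly continuous in `(W, θ)`. [cite: Rudin1980, §1.4] -/
theorem continuous_flow (u : ℂ) :
    Continuous fun z : (Fin 2 → ℂ) × ℝ => Real.cos z.2 • z.1 + Real.sin z.2 • (![u * star (z.1 1), -(u * star (z.1 0))] : Fin 2 → ℂ) := by
  have h0 : Continuous fun z : (Fin 2 → ℂ) × ℝ => z.1 0 := (continuous_apply 0).comp continuous_fst
  have h1 : Continuous fun z : (Fin 2 → ℂ) × ℝ => z.1 1 := (continuous_apply 1).comp continuous_fst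
  have hY : Continuous fun z : (Fin 2 → ℂ) × ℝ => (![u * star (z.1 1), -(u * star (z.1 0))] : Fin 2 → ℂ) :=
    (continuous_const.mul h1.star).matrixVecCons ((continuous_const.mul h0.star).neg.matrixVecCons continuous_const)
  exact ((Real.continuous_cos.comp continuous_snd).smul continuous_fst).add ((Real.continuous_sin.comp continuous_snd).smul hY)

/-- `Y_u` is continuous. [cite: Rudin1980, §1.4] -/
theorem continuous_field (u : ℂ) : Continuous fun W : Fin 2 → ℂ => (![u * star (W 1), -(u * star (W 0))] : Fin 2 → ℂ) :=
  (continuous_const.mul (continuous_apply 1).star).matrixVecCons ((continuous_const.mul (continuous_apply 0).star).neg.matrixVecCons continuous_const)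

/-- The flow is injective on `nsq`: `R_u θ W = 0 ↔ W = 0`, in the form `W ≠ 0 → R_u θ W ≠ 0` (`|u| = 1`). [cite: Rudin1980, §1.4] -/
theorem flow_ne_zero (u : ℂ) (hu : ‖u‖ = 1) (θ : ℝ) {W : Fin 2 → ℂ} (hW : W ≠ 0) :
    Real.cos θ • W + Real.sin θ • (![u * star (W 1), -(u * star (W 0))] : Fin 2 → ℂ) ≠ 0 := by
  intro h
  have h1 := nsq_flow u hu θ W
  rw [h] at h1
  have h2 : nsq (0 : Fin 2 → ℂ) = 0 := by simp [nsq]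
  rw [h2] at h1
  exact (nsq_pos_of_ne_zero hW).ne' h1.symm

/-- **EACH `R_u θ` PRESERVES LEBESGUE MEASURE ON `ℂ²`** (`|u| = 1`; §2). [cite: Rudin1980, §1.4 (1.4.7)] [cite: Folland1995, §2.2] -/
theorem measurePreserving_flow (u : ℂ) (hu : ‖u‖ = 1) (θ : ℝ) :
    MeasurePreserving (fun W : Fin 2 → ℂ => Real.cos θ • W + Real.sin θ • (![u * star (W 1), -(u * star (W 0))] : Fin 2 → ℂ)) volume volume := by
  let f : (Fin 2 → ℂ) →ₗ[ℝ] (Fin 2 → ℂ) :=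
    { toFun := fun W => Real.cos θ • W + Real.sin θ • (![u * star (W 1), -(u * star (W 0))] : Fin 2 → ℂ)
      map_add' := fun W V => by rw [field_add, smul_add, smul_add]; abel
      map_smul' := fun a W => by rw [field_real_smul, RingHom.id_apply, smul_comm (Real.sin θ) a, smul_comm (Real.cos θ) a, smul_add] }
  exact measurePreserving_of_nsq_eq f (fun W => nsq_flow u hu θ W)

end Flow

/-! ## §4 `∫_{ℂ²} DF(W)[Y W] d⁴W = 0` -/

section Angular

variable {G : Type*} [NormedAddCommGroup G] [NormedSpace ℝ G] [CompleteSpace G]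

/-- **ANGULAR INTEGRATION BY PARTS, unit `u`**: for `F : ℂ² → G` of class `C¹` on `{0}ᶜ` with `W ↦ DF(W)[Y_u W]` integrable (`Y_u W = (u W̄₁, −u W̄₀)`, `|u| = 1`):
`∫_{ℂ²} DF(W)[Y_u W] d⁴W = 0` — §1 along the measure-preserving `2π`-periodic flow `R_u` (§3), whose orbits through `W ≠ 0` avoid `0`. [cite: Rudin1980, §1.4] [cite: Folland1995, §2.2] -/
theorem integral_fderiv_apply_flowField_eq_zero (u : ℂ) (hu : ‖u‖ = 1) {F : (Fin 2 → ℂ) → G} (hF : ContDiffOn ℝ 1 F {0}ᶜ)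
    (hT : Integrable (fun W : Fin 2 → ℂ => fderiv ℝ F W ![u * star (W 1), -(u * star (W 0))])) :
    ∫ W : Fin 2 → ℂ, fderiv ℝ F W ![u * star (W 1), -(u * star (W 0))] = 0 := by
  have hu' : star u * u = 1 := by
    rw [Complex.star_def, ← Complex.normSq_eq_conj_mul_self, Complex.normSq_eq_norm_sq, hu]; norm_num
  -- the flow, the field, the integrand
  set R : ℝ → (Fin 2 → ℂ) → (Fin 2 → ℂ) := fun θ W => Real.cos θ • W + Real.sin θ • (![u * star (W 1), -(u * star (W 0))] : Fin 2 → ℂ) with hR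
  set T : (Fin 2 → ℂ) → G := fun W => fderiv ℝ F W ![u * star (W 1), -(u * star (W 0))] with hT_def
  have hRm : ∀ θ, MeasurePreserving (R θ) volume volume := fun θ => measurePreserving_flow u hu θ
  -- `{0}` is null; on its complement `F` is differentiable and `DF` is continuous
  have hU : IsOpen ({0}ᶜ : Set (Fin 2 → ℂ)) := isOpen_compl_singleton
  have hdiff : ∀ W : Fin 2 → ℂ, W ≠ 0 → HasFDerivAt F (fderiv ℝ F W) W := fun W hW =>
    ((hF.differentiableOn one_ne_zero).differentiableAt (hU.mem_nhds hW)).hasFDerivAt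
  have hcontD : ContinuousOn (fderiv ℝ F) ({0}ᶜ : Set (Fin 2 → ℂ)) := hF.continuousOn_fderiv_of_isOpen hU le_rfl
  have hae : ∀ᵐ W : Fin 2 → ℂ ∂volume, W ≠ 0 := by
    have h0 : volume ({0} : Set (Fin 2 → ℂ)) = 0 := measure_singleton 0
    exact compl_mem_ae_iff.2 h0
  -- derivative along the orbits
  have hderiv : ∀ᵐ W : Fin 2 → ℂ ∂volume, ∀ θ ∈ Icc 0 (2 * π), HasDerivAt (fun θ => F (R θ W)) (T (R θ W)) θ := by
    filter_upwards [hae] with W hW θ _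
    have hRW : R θ W ≠ 0 := flow_ne_zero u hu θ hW
    have h := (hdiff (R θ W) hRW).comp_hasDerivAt θ (hasDerivAt_flow u hu' θ W)
    exact h
  -- periodicity
  have hper : ∀ᵐ W : Fin 2 → ℂ ∂volume, F (R (2 * π) W) = F (R 0 W) := Eventually.of_forall fun W => by
    have h := flow_add_two_pi u 0 W
    rw [zero_add] at h
    simp only [hR, h]
  -- joint measurability: continuity on the full-measure open set `{W ≠ 0} × ℝ`
  have hTm : AEStronglyMeasurable (fun z : (Fin 2 → ℂ) × ℝ => T (R z.2 z.1)) ((volume : Measure (Fin 2 → ℂ)).prod (volume.restrict (Ioc 0 (2 * π)))) := by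
    set Uz : Set ((Fin 2 → ℂ) × ℝ) := {z | z.1 ≠ 0} with hUz
    have hUzo : IsOpen Uz := (isOpen_compl_singleton (x := (0 : Fin 2 → ℂ))).preimage continuous_fst
    have hflow : Continuous fun z : (Fin 2 → ℂ) × ℝ => R z.2 z.1 := continuous_flow u
    have hcont : ContinuousOn (fun z : (Fin 2 → ℂ) × ℝ => T (R z.2 z.1)) Uz := by
      have hD : ContinuousOn (fun z : (Fin 2 → ℂ) × ℝ => fderiv ℝ F (R z.2 z.1)) Uz :=
        hcontD.comp hflow.continuousOn fun z hz => flow_ne_zero u hu z.2 hz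
      have hYc : Continuous fun z : (Fin 2 → ℂ) × ℝ => (![u * star ((R z.2 z.1) 1), -(u * star ((R z.2 z.1) 0))] : Fin 2 → ℂ) :=
        (continuous_field u).comp hflow
      exact (isBoundedBilinearMap_apply.continuous).comp_continuousOn (hD.prodMk hYc.continuousOn)
    have hrestr : ((volume : Measure (Fin 2 → ℂ)).prod (volume.restrict (Ioc 0 (2 * π)))).restrict Uz =
        (volume : Measure (Fin 2 → ℂ)).prod (volume.restrict (Ioc 0 (2 * π))) := by
      refine Measure.restrict_eq_self_of_ae_mem ?_
      have hnull : ((volume : Measure (Fin 2 → ℂ)).prod (volume.restrict (Ioc 0 (2 * π)))) Uzᶜ = 0 := by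
        have hsub : Uzᶜ ⊆ ({0} : Set (Fin 2 → ℂ)) ×ˢ (univ : Set ℝ) := by
          intro z hz
          simp only [hUz, mem_compl_iff, mem_setOf_eq, not_not] at hz
          exact ⟨hz, mem_univ _⟩
        refine measure_mono_null hsub ?_
        rw [Measure.prod_prod, measure_singleton, zero_mul]
      exact mem_ae_iff.2 hnull
    have h := hcont.aestronglyMeasurable hUzo.measurableSet (μ := (volume : Measure (Fin 2 → ℂ)).prod (volume.restrict (Ioc 0 (2 * π))))
    rwa [hrestr] at h
  exact integral_eq_zero_of_periodic_flow R hRm Real.two_pi_pos F T hT hTm hderiv hper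

/-- **(A4-R) for `Y_A W = (W̄₁, −W̄₀)`** — p06's interface: `ContDiffOn ℝ 1 F {0}ᶜ`, `Integrable (W ↦ DF(W)[Y_A W])` ⇒ `∫ DF(W)[Y_A W] d⁴W = 0`. [cite: Rudin1980, §1.4] [cite: Folland1995, §2.2] -/
theorem integral_fderiv_apply_YA_eq_zero {F : (Fin 2 → ℂ) → G} (hF : ContDiffOn ℝ 1 F {0}ᶜ)
    (hT : Integrable (fun W : Fin 2 → ℂ => fderiv ℝ F W ![star (W 1), -star (W 0)])) :
    ∫ W : Fin 2 → ℂ, fderiv ℝ F W ![star (W 1), -star (W 0)] = 0 := by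
  have h := integral_fderiv_apply_flowField_eq_zero 1 (by simp) hF (by simpa using hT)
  simpa using h

/-- **(A4-R) for `Y_B W = (i W̄₁, −i W̄₀)`** — p06's interface: `ContDiffOn ℝ 1 F {0}ᶜ`, `Integrable (W ↦ DF(W)[Y_B W])` ⇒ `∫ DF(W)[Y_B W] d⁴W = 0`. [cite: Rudin1980, §1.4] [cite: Folland1995, §2.2] -/
theorem integral_fderiv_apply_YB_eq_zero {F : (Fin 2 → ℂ) → G} (hF : ContDiffOn ℝ 1 F {0}ᶜ)
    (hT : Integrable (fun W : Fin 2 → ℂ => fderiv ℝ F W ![I * star (W 1), -(I * star (W 0))])) :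
    ∫ W : Fin 2 → ℂ, fderiv ℝ F W ![I * star (W 1), -(I * star (W 0))] = 0 :=
  integral_fderiv_apply_flowField_eq_zero I (by simp) hF hT

end Angular

end BallModel

end Literature.Geometry.ComplexHyperbolic

end
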